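import Summits.AtomisticToContinuum.Crystallization.Theses.MinMeanCycleStackingLock
import Summits.AtomisticToContinuum.Crystallization.Theorems.ThreeConeCertificateDefectVanishCrystallizes
import Literature.MathematicalPhysics.StatisticalMechanics.CrystallizationLocalLimit
import Literature.MathematicalPhysics.StatisticalMechanics.CrystallizationSymmetries

/-!
# Route MinMeanCycleStackingLock — the soft assembly lemma `BasedDefectVanishCrystallizes`
# (item stmt-AtomisticToContinuum-12025)

`BasedDefectVanishCrystallizes`: the *based* hinge `BulkDefectVanishBased` (one periodic
configuration `P` of `ℝ³` such that, for every window radius `R` and tolerance `ε`, along every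
sequence of Lennard-Jones ground states all but `o(N)` particles `i` admit a linear isometry `A`
and a base point `p ∈ P.points` with the particles of `B_R(x_i)` two-way `ε`-matched to
`x_i + A((P.points - p) ∩ B̄_R)`) together with the uniform minimal distance of Lennard-Jones
ground states (`LennardJonesMinimalDistance`, PROVED in the tree) implies
`IsCrystallizing lennardJones 3` (Blanc–Lewin 2015, §2.1 (15)–(17)).

Proof (soft; stated for a general potential `V`, dimension `d` and periodic `P` as
`isCrystallizing_of_bulkDefectVanishBased`), the base-point analogue of item 0752
(`ThreeConeCertificateDefectVanishCrystallizes.isCrystallizing_of_bulkDefectVanish`, whose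
counting, chart-compactness and matching lemmas are reused):
1. *finite-motif reduction*: a base point `p = y + g` (`y` in the motif `F`, `g` in the lattice
   `G`) has `(F + G) - p = (F - y) + G`, the point set of the translate `P.translate (-y)`
   (`mem_points_translate_neg_iff`), so a based-good particle is an (unbased) good particle for one
   of the finitely many translates `P.translate (-y)`, `y ∈ F`;
2. at every scale `k` (radius `k+1`, tolerance `1/(k+1)`) the density of bad particles tends to
   `0`, so eventually in `N` there is a good particle; `Filter.extraction_forall_of_eventually`
   picks `N_k ↑`, good particles `i_k`, charts `A_k` and motif classes `y_k ∈ F`;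
3. *pigeonhole*: `F` is finite, so some `y₀ ∈ F` occurs for infinitely many `k`
   (`Filter.eventually_all_finset`); along that subsequence `χ` (scales only improve, `χ l ≥ l`)
   the recentred configurations (`τ = -x_{i}`) are matched with `A (P.translate (-y₀))` at scale `l`;
4. `eventually_matched_isometryImage` (converging charts `A → B` in the compact `O(d)`) and
   `PeriodicConfiguration.tendsto_sum_of_eventually_near'` (minimal distance ⇒ the matching is a
   local bijection) give local convergence to `(P.translate (-y₀)).isometryImage B`, `m ≡ 1`.
All `[folklore]` (Blanc–Lewin 2015, §2.2, for the role of the minimal distance).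
-/

noncomputable section

namespace Summit.AtomisticToContinuum.Crystallization.Theorems.MinMeanCycleStackingLockBasedDefectVanishCrystallizes

open Literature.MathematicalPhysics.StatisticalMechanics
open Filter Topology Metric
open Summit.AtomisticToContinuum.Crystallization.Theorems.ThreeConeCertificateDefectVanishCrystallizes

variable {d : ℕ}

/-- **Finite-motif reduction of a base point.** For `g` in the lattice of periods `G` of a
periodic configuration `F + G` and any `y`, the translate `(F - y) + G` has point set
`(F + G) - (y + g)`: `p' ∈ (F - y) + G ↔ p' + (y + g) ∈ F + G`. Applied with `y ∈ F`, the
recentred point set `(F + G) - p` of a base point `p = y + g ∈ F + G` depends only on the motif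
class `y` of `p`. [folklore] -/
theorem mem_points_translate_neg_iff (P : PeriodicConfiguration d)
    {y g : EuclideanSpace ℝ (Fin d)} (hg : g ∈ P.lattice) (p' : EuclideanSpace ℝ (Fin d)) :
    p' ∈ (P.translate (-y)).points ↔ p' + (y + g) ∈ P.points := by
  rw [P.mem_points_translate, sub_neg_eq_add]
  constructor
  · intro h
    rw [← add_assoc]
    exact P.add_mem_points h hg
  · intro h
    have h' := P.add_mem_points h (P.lattice.neg_mem hg)
    rwa [← add_assoc p' y g, add_neg_cancel_right] at h'

/-- **Soft assembly, based version (general potential, dimension and reference configuration).**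
If, for one periodic configuration `P` of `ℝᵈ`, every window radius `R > 0` and tolerance
`ε > 0`, along every sequence of ground states of `V` the density of particles `i` admitting NO
linear isometry `A` and base point `p ∈ P.points` with the particles in `B_R(x_i)` two-way
`ε`-matched to `x_i + A((P.points - p) ∩ B̄_R)` tends to `0`, and the ground states of `V` have a
uniform minimal distance `δ > 0`, then `V` crystallizes in dimension `d` in the sense of
Blanc–Lewin (`IsCrystallizing V d`): the limit is a rotated translate
`(P.translate (-y₀)).isometryImage B` of `P` (`y₀` a motif point), with multiplicity `m ≡ 1`.
[folklore] -/
theorem isCrystallizing_of_bulkDefectVanishBased {V : ℝ → ℝ} (P : PeriodicConfiguration d)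
    (hBDV : ∀ R ε : ℝ, 0 < R → 0 < ε → ∀ x : (N : ℕ) → (Fin N → EuclideanSpace ℝ (Fin d)),
      (∀ N, IsGroundState V (x N)) →
      Tendsto (fun N : ℕ => (Nat.card {i : Fin N // ¬ ∃ A : EuclideanSpace ℝ (Fin d) →ₗᵢ[ℝ]
        EuclideanSpace ℝ (Fin d), ∃ p ∈ P.points,
        (∀ q ∈ P.points, dist q p ≤ R → ∃ j : Fin N, dist (x N j) (x N i + A (q - p)) ≤ ε) ∧
        (∀ j : Fin N, dist (x N j) (x N i) ≤ R →
          ∃ q ∈ P.points, dist (x N j) (x N i + A (q - p)) ≤ ε)} : ℝ) / N) atTop (𝓝 0))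
    {δ : ℝ} (hδ : 0 < δ)
    (hsep : ∀ (N : ℕ) (x : Fin N → EuclideanSpace ℝ (Fin d)), IsGroundState V x →
      ∀ i j, i ≠ j → δ ≤ dist (x i) (x j)) :
    IsCrystallizing V d := by
  intro x hx
  -- Step 1: at every scale `k`, eventually in `N`, a good particle with its chart and motif class
  have hev : ∀ k : ℕ, ∀ᶠ N in atTop, ∃ (i : Fin N) (A : EuclideanSpace ℝ (Fin d) →ₗᵢ[ℝ]
      EuclideanSpace ℝ (Fin d)) (y : EuclideanSpace ℝ (Fin d)), y ∈ P.motif ∧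
      (∀ p' ∈ (P.translate (-y)).points, ‖p'‖ ≤ (k : ℝ) + 1 →
        ∃ j : Fin N, dist (x N j) (x N i + A p') ≤ 1 / ((k : ℝ) + 1)) ∧
      (∀ j : Fin N, dist (x N j) (x N i) ≤ (k : ℝ) + 1 →
        ∃ p' ∈ (P.translate (-y)).points, dist (x N j) (x N i + A p') ≤ 1 / ((k : ℝ) + 1)) := by
    intro k
    have ht := hBDV ((k : ℝ) + 1) (1 / ((k : ℝ) + 1)) (by positivity) (by positivity) x hx
    filter_upwards [ht.eventually (gt_mem_nhds (show (0 : ℝ) < 1 / 2 by norm_num)),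
      eventually_ge_atTop 1] with N hN hN1
    obtain ⟨i, A, p, hp, h1, h2⟩ := exists_good_of_card_div_lt hN1 hN
    obtain ⟨y, hy, g, hg, rfl⟩ := hp
    refine ⟨i, A, y, hy, fun p' hp' hp'k => ?_, fun j hj => ?_⟩
    · have hq : p' + (y + g) ∈ P.points := (mem_points_translate_neg_iff P hg p').1 hp'
      obtain ⟨j, hj⟩ := h1 (p' + (y + g)) hq (by rwa [dist_eq_norm, add_sub_cancel_right])
      exact ⟨j, by rwa [add_sub_cancel_right] at hj⟩
    · obtain ⟨q, hq, hjq⟩ := h2 j hj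
      exact ⟨q - (y + g), (mem_points_translate_neg_iff P hg _).2 (by rwa [sub_add_cancel]), hjq⟩
  -- Step 2: extract `N_k = φ k ↑`, good particles `i k`, charts `A k`, motif classes `y k`
  obtain ⟨φ, hφ, hgood⟩ := extraction_forall_of_eventually hev
  choose i A y hyF hA1 hA2 using hgood
  -- Step 3: pigeonhole on the finite motif: a class `y₀` recurring along a subsequence `χ`
  have hfreq : ∃ y₀ ∈ P.motif, ∃ᶠ k in atTop, y k = y₀ := by
    by_contra hcon
    have hall : ∀ᶠ k in atTop, ∀ y₀ ∈ P.motif, y k ≠ y₀ :=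
      (Filter.eventually_all_finset P.motif).2 fun y₀ hy₀ =>
        Filter.not_frequently.1 fun hf => hcon ⟨y₀, hy₀, hf⟩
    obtain ⟨k, hk⟩ := hall.exists
    exact hk (y k) (hyF k) rfl
  obtain ⟨y₀, -, hfreq⟩ := hfreq
  obtain ⟨χ, hχ, hyχ⟩ := extraction_of_frequently_atTop hfreq
  -- recentre along `χ`: `τ l = -x_{i (χ l)}`, `z l = x^{N_{χ l}} + τ l`
  set τ : ℕ → EuclideanSpace ℝ (Fin d) := fun l => -x (φ (χ l)) (i (χ l)) with hτ
  set z : (l : ℕ) → Fin (φ (χ l)) → EuclideanSpace ℝ (Fin d) :=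
    fun l j => x (φ (χ l)) j + τ l with hz
  have hdist : ∀ l j q, dist (z l j) q = dist (x (φ (χ l)) j) (x (φ (χ l)) (i (χ l)) + q) :=
    fun l j q => by
    show dist (x (φ (χ l)) j + -x (φ (χ l)) (i (χ l))) q = _
    rw [← dist_add_right (x (φ (χ l)) j + -x (φ (χ l)) (i (χ l))) q (x (φ (χ l)) (i (χ l))),
      neg_add_cancel_right, add_comm q]
  have hnorm : ∀ l j, ‖z l j‖ = dist (x (φ (χ l)) j) (x (φ (χ l)) (i (χ l))) := fun l j => by
    show ‖x (φ (χ l)) j + -x (φ (χ l)) (i (χ l))‖ = _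
    rw [← sub_eq_add_neg, dist_eq_norm]
  -- along `χ` the scales only improve (`l ≤ χ l`): matching with `A (χ l) (P.translate (-y₀))`
  have hz' : ∀ l : ℕ,
      (∀ p ∈ (P.translate (-y₀)).points, ‖p‖ ≤ (l : ℝ) + 1 →
        ∃ j, dist (z l j) (A (χ l) p) ≤ 1 / ((l : ℝ) + 1)) ∧
      (∀ j, ‖z l j‖ ≤ (l : ℝ) + 1 →
        ∃ p ∈ (P.translate (-y₀)).points, dist (z l j) (A (χ l) p) ≤ 1 / ((l : ℝ) + 1)) := by
    intro l
    have hl : (l : ℝ) + 1 ≤ (χ l : ℝ) + 1 := by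
      have : (l : ℝ) ≤ (χ l : ℝ) := by exact_mod_cast hχ.le_apply
      linarith
    have hl' : 1 / ((χ l : ℝ) + 1) ≤ 1 / ((l : ℝ) + 1) :=
      one_div_le_one_div_of_le (by positivity) hl
    have hyl : y (χ l) = y₀ := hyχ l
    refine ⟨fun p hp hpl => ?_, fun j hj => ?_⟩
    · have hp' : p ∈ (P.translate (-y (χ l))).points := by rw [hyl]; exact hp
      obtain ⟨j, hj⟩ := hA1 (χ l) p hp' (hpl.trans hl)
      exact ⟨j, by rw [hdist]; exact hj.trans hl'⟩
    · obtain ⟨p, hp, hjp⟩ := hA2 (χ l) j (by rw [← hnorm]; exact hj.trans hl)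
      exact ⟨p, by rw [← hyl]; exact hp, by rw [hdist]; exact hjp.trans hl'⟩
  -- Step 4: converging charts, one rotated limit configuration
  obtain ⟨ψ, B, hψ, hmatch⟩ :=
    eventually_matched_isometryImage (P.translate (-y₀)) z (fun l => A (χ l)) hz'
  -- Step 5: minimal distance + approximate matching ⇒ local convergence
  have hsep' : ∀ l (j j' : Fin (φ (χ (ψ l)))), j ≠ j' → δ ≤ dist (z (ψ l) j) (z (ψ l) j') := by
    intro l j j' hjj'
    show δ ≤ dist (x (φ (χ (ψ l))) j + τ (ψ l)) (x (φ (χ (ψ l))) j' + τ (ψ l))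
    rw [dist_add_right]
    exact hsep _ _ (hx _) j j' hjj'
  refine ⟨φ ∘ χ ∘ ψ, τ ∘ ψ, (P.translate (-y₀)).isometryImage B, fun _ => 1,
    hφ.comp (hχ.comp hψ), fun _ _ => le_rfl, fun _ _ _ => rfl, fun f hfc hf => ?_⟩
  exact ((P.translate (-y₀)).isometryImage B).tendsto_sum_of_eventually_near'
    (fun l => z (ψ l)) hδ hsep' hmatch hfc hf

/-- **Item stmt-AtomisticToContinuum-12025** (`BasedDefectVanishCrystallizes`, route
MinMeanCycleStackingLock): `BulkDefectVanishBased → LennardJonesMinimalDistance →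
IsCrystallizing lennardJones 3` — the soft assembly lemma for the based hinge, by
`isCrystallizing_of_bulkDefectVanishBased` at `V = V_LJ`, `d = 3`. [folklore] -/
theorem basedDefectVanishCrystallizes_proof :
    Summit.AtomisticToContinuum.Crystallization.Theses.MinMeanCycleStackingLock.BasedDefectVanishCrystallizes := by
  unfold Summit.AtomisticToContinuum.Crystallization.Theses.MinMeanCycleStackingLock.BasedDefectVanishCrystallizes
    Summit.AtomisticToContinuum.Crystallization.Theses.MinMeanCycleStackingLock.BulkDefectVanishBased
    LennardJonesMinimalDistance
  rintro ⟨P, hP⟩ ⟨δ, hδ, hsep⟩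
  exact isCrystallizing_of_bulkDefectVanishBased P hP hδ hsep

end Summit.AtomisticToContinuum.Crystallization.Theorems.MinMeanCycleStackingLockBasedDefectVanishCrystallizes

end
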